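import Summits.AtomisticToContinuum.Crystallization.Theses.ChessboardParticlePlanes
import Literature.MathematicalPhysics.StatisticalMechanics.PeriodicConfigurationSums
import Summits.AtomisticToContinuum.Crystallization.Theorems.ChessboardParticlePlanesLjPlaneChessboardRestack

/-!
# Crux `LjPlaneChessboard` (stmt-AtomisticToContinuum-6709), line `Sketch` — stub
# `siteSum_layers_restackUp`: the site sum of the upward restack, layer by layer

Let `Q` be a periodic configuration of `ℝ³` with two `ℝ`-independent horizontal periods, let
`x ∈ Q.points` and let `t' = τu (x 2) > x 2` be an occupied height; put `c := t' − x 2 > 0` and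
`e := e₃`.  The upward restack of the two layers `{x₂ = x 2}` and `{x₂ = t'}` is the point set

  `R := {x' + 2ck • e : k ∈ ℤ, x' ∈ Q.points, x'₂ ∈ {x 2, t'}}`.

CLAIM (the registered sub-goal).  The Lennard-Jones site sum of `x` in `R` splits as

  `∑'_{y ∈ R, y ≠ x} V(|x − y|) = ∑'_{y₂ = x 2, y ≠ x} V(|x − y|)`
  `  + ∑'_{k ≠ 0} ∑'_{y₂ = x 2} V(√(|x − y|² + (2|k|c)²))`
  `  + ∑'_{k ∈ ℤ} ∑'_{y₂ = t'} V(√(|x − y|² − (x 2 − t')² + (|2k+1|c)²))`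

(inner sums over points `y ∈ Q.points` of the indicated height), the two outer families being
summable.

PROOF.  (1) `R` is the point set of a periodic configuration (`stub_restack`), so the site sum is
(unconditionally = absolutely, in `ℝ`) summable
(`PeriodicConfiguration.summable_lennardJones_dist_three`).  (2) The map `(k, x') ↦ x' + 2ck • e`
is a bijection from `ℤ × (layer x 2 ⊔ layer t')` onto `R`: the height of the image is
`x'₂ + 2ck ∈ {x 2 + 2ck, x 2 + (2k+1)c}`, which determines `k` and the layer (parity), and `x`
itself corresponds to `(0, x)`.  Hence `{y ∈ R, y ≠ x}` is in bijection with the disjoint union of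
`{y : y₂ = x 2, y ≠ x}` (`k = 0`), `{k ≠ 0} × layer (x 2)` and `ℤ × layer t'`
(`restackUp_equiv`), and the sum is transported (`Equiv.tsum_eq`, `Summable.tsum_sum`,
`Summable.tsum_prod`, `Summable.prod`).  (3) The summands: `|x − (x' + s e)|² =
|x − x'|² − 2s(x 2 − x'₂) + s²` (`restackUp_dist_sq`); for `x'₂ = x 2` this is
`|x − x'|² + (2ck)²`, for `x'₂ = t'` it is `|x − x'|² + 2sc + s² = |x − x'|² − c² + ((2k+1)c)²`.

All elementary [folklore]; no definition and no notation is introduced.  The separation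
hypothesis of the registered signature (occupied heights pairwise `≥ 3/4` apart) is not needed.
-/

noncomputable section

namespace Summit.AtomisticToContinuum.Crystallization.Theorems.ChessboardParticlePlanesLjPlaneChessboard

open Literature.MathematicalPhysics.StatisticalMechanics

section RestackUp

/-- **Height bookkeeping of the restack.**  For `t < t'`, points `y, y'` of height `t` or `t'`
and integers `k, k'`, the equality `y + 2(t'−t)k • e₃ = y' + 2(t'−t)k' • e₃` forces `y = y'` and
`k = k'` (compare heights: `2k(t'−t)` and `(2k'+1)(t'−t)` never agree, by parity). [folklore] -/
theorem restackUp_inj {t t' : ℝ} (htt' : t < t') {y y' : EuclideanSpace ℝ (Fin 3)} {k k' : ℤ}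
    (hy : y 2 = t ∨ y 2 = t') (hy' : y' 2 = t ∨ y' 2 = t')
    (h : y + ((2 * (t' - t)) * (k : ℝ)) • EuclideanSpace.single (2 : Fin 3) (1 : ℝ) =
      y' + ((2 * (t' - t)) * (k' : ℝ)) • EuclideanSpace.single (2 : Fin 3) (1 : ℝ)) :
    y = y' ∧ k = k' := by
  have h2 : y 2 + 2 * (t' - t) * k = y' 2 + 2 * (t' - t) * k' := by
    have := congrArg (fun v : EuclideanSpace ℝ (Fin 3) => v 2) h
    simpa using this
  have hc : t' - t ≠ 0 := (sub_pos.2 htt').ne'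
  suffices hk : k = k' by
    subst hk
    exact ⟨add_right_cancel h, rfl⟩
  rcases hy with hy | hy <;> rcases hy' with hy' | hy' <;> rw [hy, hy'] at h2
  · have h3 : (t' - t) * k = (t' - t) * k' := by linear_combination h2 / 2
    exact_mod_cast mul_left_cancel₀ hc h3
  · exfalso
    have h3 : (t' - t) * (2 * k) = (t' - t) * (2 * k' + 1) := by linear_combination h2
    have h4 : (2 * k : ℝ) = 2 * k' + 1 := mul_left_cancel₀ hc h3
    have h5 : (2 * k : ℤ) = 2 * k' + 1 := by exact_mod_cast h4
    omega
  · exfalso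
    have h3 : (t' - t) * (2 * k + 1) = (t' - t) * (2 * k') := by linear_combination h2
    have h4 : (2 * k + 1 : ℝ) = 2 * k' := mul_left_cancel₀ hc h3
    have h5 : (2 * k + 1 : ℤ) = 2 * k' := by exact_mod_cast h4
    omega
  · have h3 : (t' - t) * k = (t' - t) * k' := by linear_combination h2 / 2
    exact_mod_cast mul_left_cancel₀ hc h3

/-- `|x − (y + s e₃)|² = |x − y|² − 2s(x₂ − y₂) + s²`. [folklore] -/
theorem restackUp_dist_sq (x y : EuclideanSpace ℝ (Fin 3)) (s : ℝ) :
    dist x (y + s • EuclideanSpace.single (2 : Fin 3) (1 : ℝ)) ^ 2 =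
      ‖x - y‖ ^ 2 - 2 * s * (x 2 - y 2) + s ^ 2 := by
  rw [EuclideanSpace.dist_sq_eq, EuclideanSpace.real_norm_sq_eq, Fin.sum_univ_three,
    Fin.sum_univ_three]
  simp [Real.dist_eq, sq_abs]
  ring

/-- Distance from `x` to a restacked point of the layer of `x`:
`|x − (y + 2(t'−x₂)k e₃)| = √(|x − y|² + (2|k|(t'−x₂))²)` for `y₂ = x₂`. [folklore] -/
theorem restackUp_dist_lower {x y : EuclideanSpace ℝ (Fin 3)} (h : y 2 = x 2) (t' : ℝ) (k : ℤ) :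
    dist x (y + ((2 * (t' - x 2)) * (k : ℝ)) • EuclideanSpace.single (2 : Fin 3) (1 : ℝ)) =
      Real.sqrt (‖x - y‖ ^ 2 + (2 * |(k : ℝ)| * (t' - x 2)) ^ 2) := by
  rw [← Real.sqrt_sq dist_nonneg, restackUp_dist_sq, h]
  congr 1
  simp only [mul_pow, sq_abs]
  ring

/-- Distance from `x` to a restacked point of the layer at height `t'`:
`|x − (y + 2(t'−x₂)k e₃)| = √(|x − y|² − (x₂ − t')² + (|2k+1|(t'−x₂))²)` for `y₂ = t'`.
[folklore] -/
theorem restackUp_dist_upper {x y : EuclideanSpace ℝ (Fin 3)} {t' : ℝ} (h : y 2 = t') (k : ℤ) :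
    dist x (y + ((2 * (t' - x 2)) * (k : ℝ)) • EuclideanSpace.single (2 : Fin 3) (1 : ℝ)) =
      Real.sqrt (‖x - y‖ ^ 2 - (x 2 - t') ^ 2 + (|2 * (k : ℝ) + 1| * (t' - x 2)) ^ 2) := by
  rw [← Real.sqrt_sq dist_nonneg, restackUp_dist_sq, h]
  congr 1
  simp only [mul_pow, sq_abs]
  ring

/-- **Re-indexing the punctured restack by the two layers.**  For `x ∈ Q.points` and `x 2 < t'`,
the points `y ≠ x` of the restack `R = {x' + 2(t'−x₂)k e₃ : k ∈ ℤ, x' ∈ Q.points, x'₂ ∈ {x₂, t'}}`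
are in bijection with the disjoint union of `{y ∈ Q.points : y₂ = x₂, y ≠ x}` (`k = 0`),
`{k ≠ 0} × {y ∈ Q.points : y₂ = x₂}` and `ℤ × {y ∈ Q.points : y₂ = t'}`, via
`(k, y) ↦ y + 2(t'−x₂)k e₃`. [folklore] -/
theorem restackUp_equiv (Q : PeriodicConfiguration 3) {x : EuclideanSpace ℝ (Fin 3)} {t' : ℝ}
    (hc : x 2 < t') :
    ∃ φ : ({y : EuclideanSpace ℝ (Fin 3) // y ∈ Q.points ∧ y 2 = x 2 ∧ y ≠ x} ⊕
        (({k : ℤ // k ≠ 0} × {y : EuclideanSpace ℝ (Fin 3) // y ∈ Q.points ∧ y 2 = x 2}) ⊕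
          (ℤ × {y : EuclideanSpace ℝ (Fin 3) // y ∈ Q.points ∧ y 2 = t'}))) ≃
        {y : EuclideanSpace ℝ (Fin 3) //
          y ∈ {p : EuclideanSpace ℝ (Fin 3) | ∃ k : ℤ, ∃ x' ∈ Q.points,
            (x' 2 = x 2 ∨ x' 2 = t') ∧
            p = x' + ((2 * (t' - x 2)) * (k : ℝ)) • EuclideanSpace.single (2 : Fin 3) (1 : ℝ)}
          ∧ y ≠ x},
      (∀ a, (φ (Sum.inl a)).1 = a.1) ∧
      (∀ q, (φ (Sum.inr (Sum.inl q))).1 =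
        q.2.1 + ((2 * (t' - x 2)) * (q.1.1 : ℝ)) • EuclideanSpace.single (2 : Fin 3) (1 : ℝ)) ∧
      (∀ q, (φ (Sum.inr (Sum.inr q))).1 =
        q.2.1 + ((2 * (t' - x 2)) * (q.1 : ℝ)) • EuclideanSpace.single (2 : Fin 3) (1 : ℝ)) := by
  have h0 : ∀ z : EuclideanSpace ℝ (Fin 3),
      z + ((2 * (t' - x 2)) * ((0 : ℤ) : ℝ)) • EuclideanSpace.single (2 : Fin 3) (1 : ℝ) = z := by
    intro z
    simp
  -- the points of the punctured restack, with their membership certificates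
  let mk : ∀ (k : ℤ) (y : EuclideanSpace ℝ (Fin 3)), y ∈ Q.points → (y 2 = x 2 ∨ y 2 = t') →
      y + ((2 * (t' - x 2)) * (k : ℝ)) • EuclideanSpace.single (2 : Fin 3) (1 : ℝ) ≠ x →
      {y : EuclideanSpace ℝ (Fin 3) //
        y ∈ {p : EuclideanSpace ℝ (Fin 3) | ∃ k : ℤ, ∃ x' ∈ Q.points,
          (x' 2 = x 2 ∨ x' 2 = t') ∧
          p = x' + ((2 * (t' - x 2)) * (k : ℝ)) • EuclideanSpace.single (2 : Fin 3) (1 : ℝ)}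
        ∧ y ≠ x} :=
    fun k y hy hl hne =>
      ⟨y + ((2 * (t' - x 2)) * (k : ℝ)) • EuclideanSpace.single (2 : Fin 3) (1 : ℝ),
        ⟨k, y, hy, hl, rfl⟩, hne⟩
  have mk_val : ∀ k y hy hl hne, (mk k y hy hl hne).1 =
      y + ((2 * (t' - x 2)) * (k : ℝ)) • EuclideanSpace.single (2 : Fin 3) (1 : ℝ) :=
    fun _ _ _ _ _ => rfl
  -- `x` itself is the image of `(0, x)`
  have hxx : ∀ {y : EuclideanSpace ℝ (Fin 3)} {k : ℤ}, (y 2 = x 2 ∨ y 2 = t') →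
      y + ((2 * (t' - x 2)) * (k : ℝ)) • EuclideanSpace.single (2 : Fin 3) (1 : ℝ) = x →
      y = x ∧ k = 0 :=
    fun hl h => restackUp_inj hc hl (Or.inl rfl) (h.trans (h0 x).symm)
  let fA : {y : EuclideanSpace ℝ (Fin 3) // y ∈ Q.points ∧ y 2 = x 2 ∧ y ≠ x} → _ := fun a =>
    mk 0 a.1 a.2.1 (Or.inl a.2.2.1) fun h => a.2.2.2 ((h0 a.1).symm.trans h)
  let fB : {k : ℤ // k ≠ 0} × {y : EuclideanSpace ℝ (Fin 3) // y ∈ Q.points ∧ y 2 = x 2} → _ :=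
    fun q => mk q.1.1 q.2.1 q.2.2.1 (Or.inl q.2.2.2) fun h => q.1.2 (hxx (Or.inl q.2.2.2) h).2
  let fC : ℤ × {y : EuclideanSpace ℝ (Fin 3) // y ∈ Q.points ∧ y 2 = t'} → _ :=
    fun q => mk q.1 q.2.1 q.2.2.1 (Or.inr q.2.2.2) fun h => hc.ne <| by
      rw [← q.2.2.2, (hxx (Or.inr q.2.2.2) h).1]
  have hf : Function.Bijective (Sum.elim fA (Sum.elim fB fC)) := by
    constructor
    · refine Function.Injective.sumElim ?_ (Function.Injective.sumElim ?_ ?_ ?_) ?_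
      · intro a a' h
        have h' : (fA a).1 = (fA a').1 := congrArg Subtype.val h
        exact Subtype.ext (by simpa only [fA, mk_val, h0] using h')
      · intro q q' h
        have h' : (fB q).1 = (fB q').1 := congrArg Subtype.val h
        simp only [fB, mk_val] at h'
        obtain ⟨h1, h2⟩ := restackUp_inj hc (Or.inl q.2.2.2) (Or.inl q'.2.2.2) h'
        exact Prod.ext (Subtype.ext h2) (Subtype.ext h1)
      · intro q q' h
        have h' : (fC q).1 = (fC q').1 := congrArg Subtype.val h
        simp only [fC, mk_val] at h'
        obtain ⟨h1, h2⟩ := restackUp_inj hc (Or.inr q.2.2.2) (Or.inr q'.2.2.2) h'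
        exact Prod.ext h2 (Subtype.ext h1)
      · intro q q' h
        have h' : (fB q).1 = (fC q').1 := congrArg Subtype.val h
        simp only [fB, fC, mk_val] at h'
        have h1 := (restackUp_inj hc (Or.inl q.2.2.2) (Or.inr q'.2.2.2) h').1
        exact hc.ne (by rw [← q.2.2.2, h1, q'.2.2.2])
      · rintro a (q | q) h
        · have h' : (fA a).1 = (fB q).1 := congrArg Subtype.val h
          simp only [fA, fB, mk_val] at h'
          exact q.1.2 (restackUp_inj hc (Or.inl a.2.2.1) (Or.inl q.2.2.2) h').2.symm
        · have h' : (fA a).1 = (fC q).1 := congrArg Subtype.val h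
          simp only [fA, fC, mk_val] at h'
          have h1 := (restackUp_inj hc (Or.inl a.2.2.1) (Or.inr q.2.2.2) h').1
          exact hc.ne (by rw [← a.2.2.1, h1, q.2.2.2])
    · rintro ⟨p, ⟨k, y, hy, hl, rfl⟩, hne⟩
      rcases hl with hl | hl
      · by_cases hk : k = 0
        · subst hk
          exact ⟨Sum.inl ⟨y, hy, hl, fun h => hne (by rw [h]; exact h0 x)⟩, rfl⟩
        · exact ⟨Sum.inr (Sum.inl (⟨k, hk⟩, ⟨y, hy, hl⟩)), rfl⟩
      · exact ⟨Sum.inr (Sum.inr (k, ⟨y, hy, hl⟩)), rfl⟩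
  exact ⟨Equiv.ofBijective _ hf, fun a => h0 a.1, fun q => rfl, fun q => rfl⟩

/-- **Core of `siteSum_layers_restackUp`** (the next occupied height `τu (x 2)` abstracted to a
real `t' > x 2`): summability of the two outer families and the three-term splitting of the
Lennard-Jones site sum of `x` in the upward restack. [folklore] -/
theorem restackUp_core (Q : PeriodicConfiguration 3) (x : EuclideanSpace ℝ (Fin 3)) (t' : ℝ)
    (hab : ∃ a ∈ Q.lattice, ∃ b ∈ Q.lattice, a 2 = 0 ∧ b 2 = 0 ∧ LinearIndependent ℝ ![a, b])
    (hx : x ∈ Q.points) (hc : x 2 < t') (hocc : ∃ y ∈ Q.points, y 2 = t') :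
    Summable (fun k : {k : ℤ // k ≠ 0} =>
        ∑' y : {y : EuclideanSpace ℝ (Fin 3) // y ∈ Q.points ∧ y 2 = x 2},
          lennardJones (Real.sqrt (‖x - y.1‖ ^ 2 + (2 * |(k : ℝ)| * (t' - x 2)) ^ 2))) ∧
      Summable (fun k : ℤ =>
        ∑' y : {y : EuclideanSpace ℝ (Fin 3) // y ∈ Q.points ∧ y 2 = t'},
          lennardJones (Real.sqrt (‖x - y.1‖ ^ 2 - (x 2 - t') ^ 2
            + (|2 * (k : ℝ) + 1| * (t' - x 2)) ^ 2))) ∧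
      ∑' y : {y : EuclideanSpace ℝ (Fin 3) //
          y ∈ {p : EuclideanSpace ℝ (Fin 3) | ∃ k : ℤ, ∃ x' ∈ Q.points,
            (x' 2 = x 2 ∨ x' 2 = t') ∧
            p = x' + ((2 * (t' - x 2)) * (k : ℝ)) • EuclideanSpace.single (2 : Fin 3) (1 : ℝ)}
          ∧ y ≠ x}, lennardJones (dist x y.1) =
        (∑' y : {y : EuclideanSpace ℝ (Fin 3) // y ∈ Q.points ∧ y 2 = x 2 ∧ y ≠ x},
            lennardJones (dist x y.1)) +
        (∑' k : {k : ℤ // k ≠ 0},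
          ∑' y : {y : EuclideanSpace ℝ (Fin 3) // y ∈ Q.points ∧ y 2 = x 2},
            lennardJones (Real.sqrt (‖x - y.1‖ ^ 2 + (2 * |(k : ℝ)| * (t' - x 2)) ^ 2))) +
        ∑' k : ℤ,
          ∑' y : {y : EuclideanSpace ℝ (Fin 3) // y ∈ Q.points ∧ y 2 = t'},
            lennardJones (Real.sqrt (‖x - y.1‖ ^ 2 - (x 2 - t') ^ 2
              + (|2 * (k : ℝ) + 1| * (t' - x 2)) ^ 2)) := by
  -- (1) the restack is a periodic configuration: its Lennard-Jones site sum is summable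
  obtain ⟨P, hP⟩ := stub_restack Q hab (x 2) t' hc ⟨x, hx, rfl⟩ hocc
  have hS : Summable (fun y : {y : EuclideanSpace ℝ (Fin 3) //
      y ∈ {p : EuclideanSpace ℝ (Fin 3) | ∃ k : ℤ, ∃ x' ∈ Q.points, (x' 2 = x 2 ∨ x' 2 = t') ∧
        p = x' + ((2 * (t' - x 2)) * (k : ℝ)) • EuclideanSpace.single (2 : Fin 3) (1 : ℝ)}
      ∧ y ≠ x} => lennardJones (dist x y.1)) := by
    have h := P.summable_lennardJones_dist_three x
    rw [hP] at h
    exact h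
  -- (2) re-index by the two layers
  obtain ⟨φ, hφA, hφB, hφC⟩ := restackUp_equiv Q hc
  have hSφ := φ.summable_iff.2 hS
  have hA : Summable fun a : {y : EuclideanSpace ℝ (Fin 3) // y ∈ Q.points ∧ y 2 = x 2 ∧ y ≠ x} =>
      lennardJones (dist x (φ (Sum.inl a)).1) :=
    hSφ.comp_injective Sum.inl_injective
  have hBC : Summable fun q : ({k : ℤ // k ≠ 0} ×
        {y : EuclideanSpace ℝ (Fin 3) // y ∈ Q.points ∧ y 2 = x 2}) ⊕
      (ℤ × {y : EuclideanSpace ℝ (Fin 3) // y ∈ Q.points ∧ y 2 = t'}) =>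
      lennardJones (dist x (φ (Sum.inr q)).1) :=
    hSφ.comp_injective Sum.inr_injective
  have hB : Summable fun q : {k : ℤ // k ≠ 0} ×
      {y : EuclideanSpace ℝ (Fin 3) // y ∈ Q.points ∧ y 2 = x 2} =>
      lennardJones (dist x (φ (Sum.inr (Sum.inl q))).1) :=
    hBC.comp_injective Sum.inl_injective
  have hC : Summable fun q : ℤ × {y : EuclideanSpace ℝ (Fin 3) // y ∈ Q.points ∧ y 2 = t'} =>
      lennardJones (dist x (φ (Sum.inr (Sum.inr q))).1) :=
    hBC.comp_injective Sum.inr_injective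
  -- (3) the summands in explicit form
  have eB : ∀ q : {k : ℤ // k ≠ 0} × {y : EuclideanSpace ℝ (Fin 3) // y ∈ Q.points ∧ y 2 = x 2},
      lennardJones (dist x (φ (Sum.inr (Sum.inl q))).1) =
        lennardJones (Real.sqrt (‖x - q.2.1‖ ^ 2 + (2 * |(q.1.1 : ℝ)| * (t' - x 2)) ^ 2)) :=
    fun q => by rw [hφB, restackUp_dist_lower q.2.2.2]
  have eC : ∀ q : ℤ × {y : EuclideanSpace ℝ (Fin 3) // y ∈ Q.points ∧ y 2 = t'},
      lennardJones (dist x (φ (Sum.inr (Sum.inr q))).1) =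
        lennardJones (Real.sqrt (‖x - q.2.1‖ ^ 2 - (x 2 - t') ^ 2
          + (|2 * (q.1 : ℝ) + 1| * (t' - x 2)) ^ 2)) :=
    fun q => by rw [hφC, restackUp_dist_upper q.2.2.2]
  have hB' := hB.congr eB
  have hC' := hC.congr eC
  refine ⟨hB'.prod, hC'.prod, ?_⟩
  -- (4) transport the sum and split it
  rw [← φ.tsum_eq (fun y => lennardJones (dist x y.1)),
    Summable.tsum_sum (f := fun s => lennardJones (dist x (φ s).1)) hA hBC,
    Summable.tsum_sum (f := fun q => lennardJones (dist x (φ (Sum.inr q)).1)) hB hC, ← add_assoc]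
  refine congrArg₂ (· + ·) (congrArg₂ (· + ·) ?_ ?_) ?_
  · exact tsum_congr fun a => by rw [hφA]
  · rw [tsum_congr eB]
    exact hB'.tsum_prod
  · rw [tsum_congr eC]
    exact hC'.tsum_prod

end RestackUp

/-- **Registered sub-goal `siteSum_layers_restackUp` (R1c-Up): the site sum of the upward restack
in layer form.**  For a periodic configuration `Q` of `ℝ³` with two `ℝ`-independent horizontal
periods, `x ∈ Q.points` and an occupied height `τu (x 2) > x 2`, the Lennard-Jones site sum of `x`
in the upward restack `{x' + 2(τu (x 2) − x 2)k e₃ : k ∈ ℤ, x' ∈ Q.points, x'₂ ∈ {x 2, τu (x 2)}}`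
is the in-plane part plus the sums over the restacked copies of the two layers, written with
horizontal distances and the vertical offsets `2|k|c`, `|2k+1|c` (`c = τu (x 2) − x 2`), and the two
outer families are summable. [folklore] -/
theorem siteSum_layers_restackUp :
    ∀ (Q : PeriodicConfiguration 3) (τu : ℝ → ℝ) (x : EuclideanSpace ℝ (Fin 3)),
      (∃ a ∈ Q.lattice, ∃ b ∈ Q.lattice, a 2 = 0 ∧ b 2 = 0 ∧ LinearIndependent ℝ ![a, b]) →
      (∀ x' ∈ Q.points, ∀ y ∈ Q.points, x' 2 ≠ y 2 → (3 : ℝ) / 4 ≤ |x' 2 - y 2|) →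
      x ∈ Q.points → x 2 < τu (x 2) → (∃ y ∈ Q.points, y 2 = τu (x 2)) →
      Summable (fun k : {k : ℤ // k ≠ 0} =>
        ∑' y : {y : EuclideanSpace ℝ (Fin 3) // y ∈ Q.points ∧ y 2 = x 2},
          lennardJones (Real.sqrt (‖x - y.1‖ ^ 2 + (2 * |(k : ℝ)| * (τu (x 2) - x 2)) ^ 2))) ∧
      Summable (fun k : ℤ =>
        ∑' y : {y : EuclideanSpace ℝ (Fin 3) // y ∈ Q.points ∧ y 2 = τu (x 2)},
          lennardJones (Real.sqrt (‖x - y.1‖ ^ 2 - (x 2 - τu (x 2)) ^ 2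
            + (|2 * (k : ℝ) + 1| * (τu (x 2) - x 2)) ^ 2))) ∧
      ∑' y : {y : EuclideanSpace ℝ (Fin 3) //
          y ∈ {p : EuclideanSpace ℝ (Fin 3) | ∃ k : ℤ, ∃ x' ∈ Q.points,
            (x' 2 = x 2 ∨ x' 2 = τu (x 2)) ∧
            p = x' + ((2 * (τu (x 2) - x 2)) * (k : ℝ)) • EuclideanSpace.single (2 : Fin 3) (1 : ℝ)}
          ∧ y ≠ x}, lennardJones (dist x y.1) =
        (∑' y : {y : EuclideanSpace ℝ (Fin 3) // y ∈ Q.points ∧ y 2 = x 2 ∧ y ≠ x},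
            lennardJones (dist x y.1)) +
        (∑' k : {k : ℤ // k ≠ 0},
          ∑' y : {y : EuclideanSpace ℝ (Fin 3) // y ∈ Q.points ∧ y 2 = x 2},
            lennardJones (Real.sqrt (‖x - y.1‖ ^ 2 + (2 * |(k : ℝ)| * (τu (x 2) - x 2)) ^ 2))) +
        ∑' k : ℤ,
          ∑' y : {y : EuclideanSpace ℝ (Fin 3) // y ∈ Q.points ∧ y 2 = τu (x 2)},
            lennardJones (Real.sqrt (‖x - y.1‖ ^ 2 - (x 2 - τu (x 2)) ^ 2
              + (|2 * (k : ℝ) + 1| * (τu (x 2) - x 2)) ^ 2)) :=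
  fun Q τu x hab _ hx hc hocc => restackUp_core Q x (τu (x 2)) hab hx hc hocc

end Summit.AtomisticToContinuum.Crystallization.Theorems.ChessboardParticlePlanesLjPlaneChessboard

end
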